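import Summits.BirchSwinnertonDyer.Rank1Residual.X10.ResidualSelmerGeneratorTestRecord118810j1
import Summits.BirchSwinnertonDyer.Rank1Residual.X10.ResidualSelmerCompanions
import Summits.BirchSwinnertonDyer.Rank1Residual.X10.SelmerCompanionsTamagawaFree
import Summits.BirchSwinnertonDyer.Rank1Residual.GaloisImage.ThreeCongruenceHesseCertificateLemmas
import Literature.NumberTheory.EllipticCurves.Fisher2012.HesseFamilyThreeReverseProofs
import HarnessLib

/-!
# N2 (X10b @ 3): THE GENERATOR TEST (G) TEMPLATE APPLIED — part B: `341138b1`, `341138j1` ← `341138q1` (ℓ = 2)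
# (cell `b2b-bsdres`, unit `b2b-bsdres-x10` = N2 class lead, GEN 32; RECORDS — theorems only, no
# definition; named-fact hypotheses DISPLAYED: `poitouTate_selmerStructure_duality ℚ` (PT),
# `selmerLocalKer_iff_of_goodReduction_above` (hMR) for the transports; census `#Sel₃(E′) = 3` of the
# rank-1 partner displayed; nothing booked)

HONEST FRAMING (run/shared/lean/b2b/bsd-rank1-residual/, verbatim in every file): the goal of the
cell is to DELETE the COMBINATION-SHAPED residual classes of the Birch–Swinnerton-Dyer formula for
ALL analytic-rank `≤ 1` elliptic curves over `ℚ` — "full BSD formula for every rank `≤ 1` curve in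
class `C`" assembled STRICTLY from published theorems — so that the rank-`≤ 1` remainder becomes
exactly the CONSTRUCTION-SHAPED classes, which are TYPED (missing-input `Prop`s), NOT attempted.
This is not "finishing BSD". Class X10b (= N2) keeps its label CONSTRUCTION-SHAPED (NEEDS `X_A3`,
referee R82.3 / RESIDUAL-MAP §I N2); these are RECORDS (evidence for the TRIVIAL-ROADS memo §9 rows
"S⁰ = 0 by (G) at a partner", now read in the kernel); no mark / label / tier / count of record moves.

## What

The template of `X10/ResidualSelmerGeneratorTestRecord118810j1.lean` (x10 GEN 32): for a rank-`1`
curve `E′` (Cremona: `r = 1`, `E′(ℚ)_tors = 0`, `Ш_an = 1`, so the census reads `#Sel₃(E′) = 3`) whose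
ONLY Tamagawa-`3` place is a SPLIT `I₃` place `ℓ` and whose generator `P` reduces to the node `mod ℓ`:
`localKummerMap_not_mem_unramified_e<E′>` (`κ_ℓ(P) ∉ H¹_ur`, every `E`-side datum by `decide +kernel`:
the Tate row at `ℓ`, `ord_ℓ Δ = 3`, the translate to the node, the `ℓ`-adic size of `x − r`, `y − t`),
`residualSelmerGroup_eq_bot_e<E′>` (`S⁰(E′) = ⊥` modulo PT + the census, by `generatorTest_of_rowCheck`),
and for each N2 cell `E` `3`-congruent to `E′` a KERNEL congruence `torsionIso_e<E>_e<E′>` (Fisher's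
Hesse pencils, certificate `(kind, l, m, u)` by n1011-p07 `certlib` over n1011-r2 `hesse3lib`) with
`residualSelmerGroup_eq_bot_e<E>` (`S⁰(E) = ⊥` modulo PT + hMR + the census of `E′`, by
`ResidualSelmerCompanions.residualSelmerGroup_eq_bot_iff_of_congr`; both curves good at `3`).
Cells of this part: 341138b1, 341138j1 (both NOGO-anomalous EVEN: NEW S⁰ determinations). Generator `g32/gen/mkgentest32.py`, data `g32/out/gentest32.json`
(Cremona `allgens`/`allbsd`, n1011-p03 `tamcert` rows).

References: [MazurRubin2007] Prop. 1.3 (i), Thm. 1.4; [MazurRubin2015SelmerCompanions] Thm. 3.1 (iv)(b);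
[Fisher2012Hessian] Thm. 13.2, §13; [SilvermanAEC2009] VII.1.3(b), X.§4; [Cremona2006] Table 1;
HOME/class-closure/N2/TRIVIAL-ROADS-x10g27.md §9; HOME/X10-AUDIT.md §38.9.
-/

set_option autoImplicit false

noncomputable section

open scoped Classical NNReal

open Function NumberField IsDedekindDomain Field WeierstrassCurve IsLocalRing
  Literature.NumberTheory.EllipticCurves Literature.NumberTheory.GaloisRepresentations
  Literature.NumberTheory.GaloisCohomology IsDedekindDomain.HeightOneSpectrum Rat.HeightOneSpectrum
  Literature.NumberTheory.EllipticCurves.MazurRubin2015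
  Literature.NumberTheory.EllipticCurves.Fisher2012
  Summit.BirchSwinnertonDyer.BirchSwinnertonDyer.Rank1Residual.IntModel
  Summit.BirchSwinnertonDyer.BirchSwinnertonDyer.Theorems.Rank1ResidualX1Defs
  Summit.BirchSwinnertonDyer.Rank1Residual.X11b
  Summit.BirchSwinnertonDyer.Rank1Residual.GaloisImage
  Summit.BirchSwinnertonDyer.Rank1Residual.X1.CongruenceTransfer
open Literature.NumberTheory.GaloisRepresentations.DiscreteGaloisModule (unramifiedSubgroup)
open Summit.BirchSwinnertonDyer.BirchSwinnertonDyer.Rank2Observatory.Tam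
open Summit.BirchSwinnertonDyer.Rank1Residual.Additive
open Summit.BirchSwinnertonDyer.Rank1Residual.X10.ResidualSelmerGroup
open Summit.BirchSwinnertonDyer.Rank1Residual.X10.ResidualSelmerParityRat
open Summit.BirchSwinnertonDyer.Rank1Residual.X10.ResidualSelmerLocalRamificationInt
open Summit.BirchSwinnertonDyer.Rank1Residual.X10.ResidualSelmerLocalRamificationRat
open Summit.BirchSwinnertonDyer.Rank1Residual.X10.ResidualSelmerCompanions
open Summit.BirchSwinnertonDyer.Rank1Residual.X10.SelmerCompanionsTamagawaFree
open Summit.BirchSwinnertonDyer.Rank1Residual.X10.ResidualSelmerGeneratorTestRecord118810j1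

namespace Summit.BirchSwinnertonDyer.Rank1Residual.X10.ResidualSelmerGeneratorTestRecords

/-! ### Partner `341138q1 = [1, 0, 0, -2108, 42664]` — `r = 1`, `E(ℚ)_tors = 0`, `Ш_an = 1`; 2: In (c = 3); 7: I0* (c = 1); 59: III (c = 2); `P = (54, 268)` -/

/-- The rational point `P = (54, 268)` (Cremona's generator) lies on `341138q1`.
[cite: Cremona2006, Table 1 (Cremona label 341138q1)] -/
theorem nonsingular_point_e341138q1 :
    ((⟨1, 0, 0, -2108, 42664⟩ : WeierstrassCurve ℤ).baseChange ℚ).toAffine.Nonsingular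
      (54 : ℚ) (268 : ℚ) := by
  rw [Affine.nonsingular_iff, Affine.equation_iff]
  simp only [baseChange, map_a₁, map_a₂, map_a₃, map_a₄, map_a₆]
  norm_num

/-- **`κ_2(P)` is RAMIFIED** for `P = (54, 268) ∈ 341138q1(ℚ)` at the split `I₃` place `2`
(`P ≡ (0, 0)` = the node `mod 2`; translate `(r, t) = (0, 0)`: `x − r = 54/1`, `y − t = 268/1`);
all `E`-side data in the kernel; no named fact. [cite: SilvermanAEC2009, VII.1 Prop. 1.3(b) and X.§4 diagram (**)]
[cite: MazurRubin2007, proof of Thm. 1.4] -/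
theorem localKummerMap_not_mem_unramified_e341138q1
    (W : WeierstrassCurve ℚ) [W.IsElliptic] [hGM : W.IsGloballyMinimal]
    (hI : integralModelInt W = ⟨1, 0, 0, -2108, 42664⟩)
    (hP : W.toAffine.Nonsingular (54 : ℚ) (268 : ℚ))
    (v : HeightOneSpectrum (𝓞 ℚ)) (hv : natGenerator v = 2) (hp0 : ((3 : ℕ) : ℤ) ≠ 0) :
    W.localKummerMap (v.adicCompletion ℚ) hp0
        (Affine.Point.baseChange (W' := W) ℚ (v.adicCompletion ℚ) (.some _ _ hP)) ∉
      unramifiedSubgroup ((W.torsionGaloisModule ((3 : ℕ) : ℤ)).restrictField (v.adicCompletion ℚ)) 1 := by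
  have hW : W = (⟨1, 0, 0, -2108, 42664⟩ : WeierstrassCurve ℤ).baseChange ℚ :=
    IntModelTam.eq_baseChange_of_integralModelInt hI
  subst hW
  have hpv : ((3 : ℕ) : 𝓞 ℚ) ∉ v.asIdeal := fun h => by
    have h' := (natCast_mem_asIdeal_iff_natGenerator_eq Nat.prime_three v).mp h
    rw [hv] at h'
    exact absurd h' (by decide)
  have hcheck : TamLocal.check ⟨2, 1, 1, 0, 0, 0, 0, 3, 0, 0, 3⟩
      (⟨1, 0, 0, -2108, 42664⟩ : WeierstrassCurve ℤ) = true := by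
    decide +kernel
  have hsplit : ((⟨1, 0, 0, -2108, 42664⟩ : WeierstrassCurve ℤ).baseChange ℚ).HasSplitMultiplicativeReductionAt v :=
    hasSplitMultiplicativeReductionAt_of_check hcheck rfl v hv
  have hn : ((⟨1, 0, 0, -2108, 42664⟩ : WeierstrassCurve ℤ).baseChange ℚ).ordMinimalDiscriminant v = 3 :=
    ordMinimalDiscriminant_int_eq hv (hGM.isMinimal v) (by decide +kernel) (by decide +kernel)
  have hX := baseChange_map_int_adicCompletion ⟨1, 0, 0, -2108, 42664⟩ v
  rw [localKummerMap_mem_unramifiedSubgroup_iff_hasNonsingularReduction_int _ v hpv hsplit hn hp0 hX]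
  have h' : ((((⟨1, 0, 0, -2108, 42664⟩ : WeierstrassCurve ℤ).map
        (Int.castRingHom (v.adicCompletionIntegers ℚ))).baseChange (v.adicCompletion ℚ))).toAffine.Nonsingular
      (algebraMap ℚ (v.adicCompletion ℚ) (54 : ℚ)) (algebraMap ℚ (v.adicCompletion ℚ) (268 : ℚ)) := by
    rw [hX]
    exact (Affine.map_nonsingular (W := ((⟨1, 0, 0, -2108, 42664⟩ : WeierstrassCurve ℤ).baseChange ℚ))
      (algebraMap ℚ (v.adicCompletion ℚ)).injective _ _).mpr hP
  have hbc : Affine.Point.congrEquiv hX.symm (Affine.Point.baseChange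
      (W' := ((⟨1, 0, 0, -2108, 42664⟩ : WeierstrassCurve ℤ).baseChange ℚ)) ℚ (v.adicCompletion ℚ)
        (.some _ _ hP)) = .some _ _ h' := by
    rw [Affine.Point.baseChange, Affine.Point.map_some, Affine.Point.congrEquiv_some]
    exact point_some_congr (Algebra.ofId_apply _ _) (Algebra.ofId_apply _ _)
  rw [hbc]
  exact not_hasNonsingularReduction_of_reduces_to_node v ⟨1, 0, 0, -2108, 42664⟩ 0 0
    (by rw [hv]; decide +kernel) (by rw [hv]; decide +kernel) (m := 54) (n := 1) (m' := 268) (n' := 1)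
    (by rw [hv]; decide +kernel) (by rw [hv]; decide +kernel) (by rw [hv]; decide +kernel)
    (by rw [hv]; decide +kernel) (by norm_num) (by norm_num) h'

/-- **`S⁰(341138q1) = ⊥` — the generator test (G) DECIDED IN THE KERNEL** for the rank-`1` partner
`341138q1`: the Kummer class of its generator is a non-zero Selmer class RAMIFIED at `2`, so the first
alternative of `generatorTest_of_rowCheck` (ℓ₀ = 2) applies. CONDITIONAL on the Poitou–Tate fact and
the census `hs : #Sel₃ = 3` (`r = 1`, trivial torsion, `Ш_an = 1`); nothing else; nothing booked.
[cite: MazurRubin2007, Prop. 1.3 (i) and Thm. 1.4] [cite: Cremona2006, Table 1 (Cremona label 341138q1)] -/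
theorem residualSelmerGroup_eq_bot_e341138q1 (hfact : poitouTate_selmerStructure_duality ℚ)
    (W : WeierstrassCurve ℚ) [W.IsElliptic] [W.IsGloballyMinimal]
    (hI : integralModelInt W = ⟨1, 0, 0, -2108, 42664⟩)
    (hs : Nat.card (W.selmerGroup (3 : ℤ)) = 3) : residualSelmerGroup W 3 = ⊥ := by
  have hP : W.toAffine.Nonsingular (54 : ℚ) (268 : ℚ) := by
    rw [IntModelTam.eq_baseChange_of_integralModelInt hI]; exact nonsingular_point_e341138q1
  have hp0 : ((3 : ℕ) : ℤ) ≠ 0 := by norm_num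
  have hdiv : ∀ P : geomPoints W, ∃ Q : geomPoints W, ((3 : ℕ) : ℤ) • Q = P :=
    W.zsmul_geomPoints_surjective_holds (by norm_num)
  have hloc := localKummerMap_not_mem_unramified_e341138q1 W hI hP (pl 2)
    (natGenerator_pl (by norm_num)) hp0
  have key := KummerIndex.res_kummerMapTorsion_eq_localKummerMap W ((pl 2).adicCompletion ℚ) hp0 hdiv
    (.some _ _ hP)
  have hloc' : galoisCohomology.res (W.torsionGaloisModule ((3 : ℕ) : ℤ)) ((pl 2).adicCompletion ℚ) 1
        (kummerMapTorsion W ((3 : ℕ) : ℤ) hdiv (.some _ _ hP)) ∉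
      unramifiedSubgroup ((W.torsionGaloisModule ((3 : ℕ) : ℤ)).restrictField
        ((pl 2).adicCompletion ℚ)) 1 := by
    intro h
    rw [key] at h
    exact hloc h
  have hram : galoisCohomology.localization (W.torsionGaloisModule ((3 : ℕ) : ℤ)) (Sum.inr (pl 2)) 1
        (kummerMapTorsion W ((3 : ℕ) : ℤ) hdiv (.some _ _ hP)) ∉
      unramifiedSubgroup (GaloisRep.toLocal (pl 2) (W.torsionGaloisModule ((3 : ℕ) : ℤ))) 1 :=
    fun h => hloc' ((localization_inr_mem_unramifiedSubgroup_iff W ((3 : ℕ) : ℤ) (pl 2) _).mp h)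
  have hc : kummerMapTorsion W ((3 : ℕ) : ℤ) hdiv (.some _ _ hP) ∈ W.selmerGroup ((3 : ℕ) : ℤ) :=
    kummerMapTorsion_mem_selmerGroup W _ hdiv _
  have hc0 : kummerMapTorsion W ((3 : ℕ) : ℤ) hdiv (.some _ _ hP) ≠ 0 := fun h0 => hloc' (by
    have hz : galoisCohomology.res (W.torsionGaloisModule ((3 : ℕ) : ℤ)) ((pl 2).adicCompletion ℚ) 1
        (kummerMapTorsion W ((3 : ℕ) : ℤ) hdiv (.some _ _ hP)) = 0 := by
      rw [h0]; exact (galoisCohomology.res _ _ 1).map_zero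
    rw [hz]; exact zero_mem _)
  exact (generatorTest_of_rowCheck 3 (by decide) hfact W hI
    (Es := [⟨2, 1, 1, 0, 0, 0, 0, 3, 0, 0, 3⟩, ⟨7, 2, 5, 0, 4, 3, 47, 6, 6, 0, 1⟩, ⟨59, 7, 4, 0, 54, 0, 32, 3, 3, 2, 2⟩])
    (by decide +kernel) (ℓ₀ := 2) (by decide +kernel) (by decide +kernel) hs hc hc0).1 hram


/-! ### Cell `341138b1 = [1, 0, 1, -7338021, -8798979640]` (NOGO-anomalous (EVEN)) ← partner `341138q1`: DUAL Hesse certificate `(l : m) = (2065 : 1)`, `u = 1/413` -/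

/-- **`341138b1[3] ≃ 341138q1[3]` as `Γ_ℚ`-modules, IN THE KERNEL** (no named fact): `341138b1` is `ℚ`-isomorphic to the
member `(l : m) = (2065 : 1)`, `u = 1/413`, of the DUAL Hesse pencil `X_E⁻(3)` (Fisher 2012 §13; tree THEOREM `thm132rev_threeCongruent_dualHessePencil_holds`) of `341138q1`; the two covariant
identities are numeral identities (`norm_num`). [cite: Fisher2012Hessian, §13 (analogue of Thm. 13.2 for X_E^-(3)) and §8]
[cite: Cremona2006, Table 1 (Cremona labels 341138b1, 341138q1)] -/
theorem torsionIso_e341138b1_e341138q1 (W A : WeierstrassCurve ℚ) [W.IsElliptic] [A.IsElliptic]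
    (hW : W = ⟨1, 0, 0, -2108, 42664⟩) (hA : A = ⟨1, 0, 1, -7338021, -8798979640⟩) :
    TorsionIso A W 3 :=
  VisCerts.torsionIso3_of_dualHesseCert_mk thm132rev_threeCongruent_dualHessePencil_holds
    hW hA
    (101185 : ℚ) (-37013473 : ℚ) (352224985 : ℚ) (7601790071267 : ℚ)
    (by norm_num) (by norm_num) (by norm_num) (by norm_num)
    (2065 : ℚ) (1 : ℚ) ((1 : ℚ) / 413) (by norm_num) (by norm_num) (by norm_num)

/-- **`S⁰(341138b1) = ⊥` IN THE KERNEL** (modulo the displayed PT fact, hMR, and the partner's census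
`#Sel₃(341138q1) = 3`): the partner's generator test `residualSelmerGroup_eq_bot_e341138q1` transported along
`torsionIso_e341138b1_e341138q1` by `residualSelmerGroup_eq_bot_iff_of_congr` (both curves good at `3`, `decide`
on `Δ`). Per cell; EVIDENCE for TRIVIAL-ROADS §9; nothing booked, no count moved here.
[cite: MazurRubin2007, Prop. 1.3 (i) and Thm. 1.4] [cite: MazurRubin2015SelmerCompanions, Thm. 3.1 (iv)(b)]
[cite: Cremona2006, Table 1 (Cremona labels 341138b1, 341138q1)] -/
theorem residualSelmerGroup_eq_bot_e341138b1 (hfact : poitouTate_selmerStructure_duality ℚ)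
    (hMR : selmerLocalKer_iff_of_goodReduction_above)
    (W A : WeierstrassCurve ℚ) [W.IsElliptic] [W.IsGloballyMinimal] [A.IsElliptic] [A.IsGloballyMinimal]
    (hIW : integralModelInt W = ⟨1, 0, 1, -7338021, -8798979640⟩)
    (hIA : integralModelInt A = ⟨1, 0, 0, -2108, 42664⟩)
    (hsA : Nat.card (A.selmerGroup (3 : ℤ)) = 3) : residualSelmerGroup W 3 = ⊥ := by
  have hW : W = ⟨1, 0, 1, -7338021, -8798979640⟩ := by
    rw [IntModelTam.eq_baseChange_of_integralModelInt hIW]; ext <;> simp [baseChange, WeierstrassCurve.map]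
  have hA : A = ⟨1, 0, 0, -2108, 42664⟩ := by
    rw [IntModelTam.eq_baseChange_of_integralModelInt hIA]; ext <;> simp [baseChange, WeierstrassCurve.map]
  obtain ⟨θ, hθ⟩ := torsionIso_e341138b1_e341138q1 A W hA hW
  have hgood : ∀ v : HeightOneSpectrum (𝓞 ℚ), ((3 : ℕ) : 𝓞 ℚ) ∈ v.asIdeal →
      A.HasGoodReductionAt v ∧ W.HasGoodReductionAt v := fun v hv =>
    ⟨hasGoodReductionAt_of_map_eq_of_not_dvd (p := 3) A (hIA ▸ map_integralModelInt A)
        (by decide +kernel) v hv,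
      hasGoodReductionAt_of_map_eq_of_not_dvd (p := 3) W (hIW ▸ map_integralModelInt W)
        (by decide +kernel) v hv⟩
  exact (residualSelmerGroup_eq_bot_iff_of_congr A W 3 hMR (by decide) θ hθ hgood).mpr
    (residualSelmerGroup_eq_bot_e341138q1 hfact A hIA hsA)


/-! ### Cell `341138j1 = [1, 0, 1, 8010, 391752]` (NOGO-anomalous (EVEN)) ← partner `341138q1`: DUAL Hesse certificate `(l : m) = (49 : 1)`, `u = 1/413` -/

/-- **`341138j1[3] ≃ 341138q1[3]` as `Γ_ℚ`-modules, IN THE KERNEL** (no named fact): `341138j1` is `ℚ`-isomorphic to the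
member `(l : m) = (49 : 1)`, `u = 1/413`, of the DUAL Hesse pencil `X_E⁻(3)` (Fisher 2012 §13; tree THEOREM `thm132rev_threeCongruent_dualHessePencil_holds`) of `341138q1`; the two covariant
identities are numeral identities (`norm_num`). [cite: Fisher2012Hessian, §13 (analogue of Thm. 13.2 for X_E^-(3)) and §8]
[cite: Cremona2006, Table 1 (Cremona labels 341138j1, 341138q1)] -/
theorem torsionIso_e341138j1_e341138q1 (W A : WeierstrassCurve ℚ) [W.IsElliptic] [A.IsElliptic]
    (hW : W = ⟨1, 0, 0, -2108, 42664⟩) (hA : A = ⟨1, 0, 1, 8010, 391752⟩) :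
    TorsionIso A W 3 :=
  VisCerts.torsionIso3_of_dualHesseCert_mk thm132rev_threeCongruent_dualHessePencil_holds
    hW hA
    (101185 : ℚ) (-37013473 : ℚ) (-384503 : ℚ) (-337897189 : ℚ)
    (by norm_num) (by norm_num) (by norm_num) (by norm_num)
    (49 : ℚ) (1 : ℚ) ((1 : ℚ) / 413) (by norm_num) (by norm_num) (by norm_num)

/-- **`S⁰(341138j1) = ⊥` IN THE KERNEL** (modulo the displayed PT fact, hMR, and the partner's census
`#Sel₃(341138q1) = 3`): the partner's generator test `residualSelmerGroup_eq_bot_e341138q1` transported along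
`torsionIso_e341138j1_e341138q1` by `residualSelmerGroup_eq_bot_iff_of_congr` (both curves good at `3`, `decide`
on `Δ`). Per cell; EVIDENCE for TRIVIAL-ROADS §9; nothing booked, no count moved here.
[cite: MazurRubin2007, Prop. 1.3 (i) and Thm. 1.4] [cite: MazurRubin2015SelmerCompanions, Thm. 3.1 (iv)(b)]
[cite: Cremona2006, Table 1 (Cremona labels 341138j1, 341138q1)] -/
theorem residualSelmerGroup_eq_bot_e341138j1 (hfact : poitouTate_selmerStructure_duality ℚ)
    (hMR : selmerLocalKer_iff_of_goodReduction_above)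
    (W A : WeierstrassCurve ℚ) [W.IsElliptic] [W.IsGloballyMinimal] [A.IsElliptic] [A.IsGloballyMinimal]
    (hIW : integralModelInt W = ⟨1, 0, 1, 8010, 391752⟩)
    (hIA : integralModelInt A = ⟨1, 0, 0, -2108, 42664⟩)
    (hsA : Nat.card (A.selmerGroup (3 : ℤ)) = 3) : residualSelmerGroup W 3 = ⊥ := by
  have hW : W = ⟨1, 0, 1, 8010, 391752⟩ := by
    rw [IntModelTam.eq_baseChange_of_integralModelInt hIW]; ext <;> simp [baseChange, WeierstrassCurve.map]
  have hA : A = ⟨1, 0, 0, -2108, 42664⟩ := by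
    rw [IntModelTam.eq_baseChange_of_integralModelInt hIA]; ext <;> simp [baseChange, WeierstrassCurve.map]
  obtain ⟨θ, hθ⟩ := torsionIso_e341138j1_e341138q1 A W hA hW
  have hgood : ∀ v : HeightOneSpectrum (𝓞 ℚ), ((3 : ℕ) : 𝓞 ℚ) ∈ v.asIdeal →
      A.HasGoodReductionAt v ∧ W.HasGoodReductionAt v := fun v hv =>
    ⟨hasGoodReductionAt_of_map_eq_of_not_dvd (p := 3) A (hIA ▸ map_integralModelInt A)
        (by decide +kernel) v hv,
      hasGoodReductionAt_of_map_eq_of_not_dvd (p := 3) W (hIW ▸ map_integralModelInt W)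
        (by decide +kernel) v hv⟩
  exact (residualSelmerGroup_eq_bot_iff_of_congr A W 3 hMR (by decide) θ hθ hgood).mpr
    (residualSelmerGroup_eq_bot_e341138q1 hfact A hIA hsA)

end Summit.BirchSwinnertonDyer.Rank1Residual.X10.ResidualSelmerGeneratorTestRecords

end
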